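import Literature.MathematicalPhysics.QuantumFieldTheory.Balaban1983to89.B2Sect2BDensities
import Literature.MathematicalPhysics.QuantumFieldTheory.Balaban1983to89.B1Ineq352Proof

/-!
# `Balaban1983to89.B2Eq293ExternalField` — [Balaban1982Higgs2] (2.93)–(2.98) pp. 576–577: the multi-scale external field
`Bʲ(Λ₂^{(j)})Ã^{(k),L^{−j}}` of the factors `Z^{(j)}` after the translation (2.80) — the display (2.93) PROVED EXACTLY from
r14's (2.51) `B2Sect2BDensities.aTilde251` under the nesting of the cut-offs, and the regularity verification (2.95)–(2.98)
for its *"remaining part"* `B̃`: the collapse to ONE scale off the slices (2.95), the product rule in a slice (2.96) (exact),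
and the assembly (2.97)–(2.98) `|∂B̃(x)| ≤ O(1)p(Lʲε)` from Lemma 2.3's printed conclusions

statement-level skeleton of published theorems with citation tags; proofs where landed; nothing here is a claim about the Yang–Mills mass gap

PDF held: `paper:balaban1982-cmp86-higgs23-ii` (T. Bałaban, *(Higgs)₂,₃ quantum fields in a finite volume. II. An upper
bound*, Commun. Math. Phys. **86** (1982) 555–594, doi 10.1007/bf01214890; journal page = PDF page + 554); pp. 576–577
[PDF 22–23] READ AS IMAGES on the ×2 renders
`run/shared/lean/pub/pub-balaban/b2b-balaban-ref1/pages/1982-cmp86-higgs23-II/1982-cmp86-higgs23-II-p022-x2.png`, `…-p023-x2.png`;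
pp. 567, 569 [PDF 13, 15] for `θ_k` and (2.51).

CITATION HEADER — WHAT IS REPRODUCED.  The displays (2.92)–(2.98) pp. 576–577 have NO SKELETON row today (ROWS-B2 jumps
from B2.Eq2.86 to B2.Eq2.103; row requests for pp. 574–577 are with the B2 fold owner r02, HOME/STATUS 2026-08-21T12:15:16Z /
12:33:34Z); companion of the seat's `…B2Eq287Translation` ((2.80)/(2.87), p268882) and `…B2Eq289Decomposition` ((2.88)–(2.91),
p270977).  Unit `lit-balaban-p15` gen 5 (Phase-2 proof seat p15; HOME `run/shared/lean/pub/lit-balaban/`, seat dir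
`lit-balaban-p15/`); B2 fold owner r02, second reader r14 (whose (2.51) carrier `aTilde251`, `Nested`, `aTilde251_eq_aTilde245`
this file extends BY NAME); referee ref-4.  Also by name: `B1Ineq352Proof.pFn_anti` (r-seat B1: `p(·)` is antitone on (0,1]).

WHAT IS PRINTED (pp. 576–577 [PDF 22–23], verbatim).  *"The expression (2.92) depends on the configuration
Bʲ(Λ₂^{(j)})Ã^{(k),L^{−j}}. This configuration, after the translation (2.80) and using the formulas (2.51), (2.88), (2.89), is
given by  Bʲ(Λ₂^{(j)})Ã^{(k),L^{−j}} = Bʲ(Λ₂^{(j)})(1 − θ_{j+2})θ_{j+1}A^{(j+1),L^{−j}} + Σ_{l=j+2}^{k−1}(1 − θ_{l+1})θ_lA^{(l),L^{−j}}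
+ (1 − θ_{k+1})θ_kA^{(k),L^{−j}} + θ_{k+1}B^{(k+1),L^{−j}} + (θ_{k+1}A′^{(k),L^{−j}} + B̃^{(k),L^{−j}}).  (2.93)  We will need to
apply Propositions I.2.1–I.2.3 to operators with external vector field equal to (2.93), so we have to verify the assumption
of regularity (I.2.23) for this field. From (2.90) and (2.91) it follows that |(∂^{L^{−j}}_μ(θ_{k+1}A′^{(k),L^{−j}} +
B̃^{(k),L^{−j}}))(x)| ≦ O(1)(Lʲη)^{d/2}p(Lᵏε) ≦ O(1)p(Lʲε),  (2.94)  so the field Ã := θ_{k+1}A′^{(k),L^{−j}} + B̃^{(k),L^{−j}}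
satisfies this assumption. Let us consider the remaining part of the expression (2.93) and let us denote it by B̃. The
derivative (∂^{L^{−j}}_μB̃)(x) of this configuration is equal to one of the derivatives (∂^{L^{−j}}_μA^{(l),L^{−j}})(x) or to
(∂^{L^{−j}}_μB^{(k+1),L^{−j}})(x) if the point x does not lie in a slice of thickness M surrounding one of the sets Bˡ(Λ₂^{(l)}).
For examples, if x belongs to Bˡ(Λ₂^{(l−1)′}∩Λ₂^{(l)c}) with the exception of the slice, then Lemma 2.3 implies
|(∂^{L^{−j}}_μB̃)(x)| = |(∂^{L^{−j}}_μA^{(l),L^{−j}})(x)| ≦ O(1)(L^{j−l})^{d/2}p(Lˡε) ≦ O(1)p(Lʲε).  (2.95)  If x belongs to this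
slice, then the above inequality implies  (∂^{L^{−j}}_μB̃)(x) = (∂^{L^{−j}}_μ(1 − θ_{l+1})A^{(l),L^{−j}})(x) +
(∂^{L^{−j}}_μθ_{l+1}A^{(l+1),L^{−j}})(x) = (∂^{L^{−j}}_μθ_{l+1})(x)(A^{(l+1),L^{−j}}(x) − A^{(l),L^{−j}}(x)) + O(p(Lʲε)),  (2.96)  and
applying Lemma 2.3, we have  A^{(l+1),L^{−j}}(x) − A^{(l),L^{−j}}(x) = A_{l+1}(y′) − A_l(y) + (L^{j−l})^{(d−2)/2}O(p(Lˡε)),  (2.97)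
where x ∈ B^{l+1}(y′), x ∈ Bˡ(y), thus y ∈ B(y′) and the restrictions on the fields A_l, A_{l+1} on the set Λ₀^{(l)} imply
A_{l+1}(y′) − A_l(y) = (L^{j−l})^{(d−2)/2}O(p(Lˡε))  again. These inequalities give us finally  |(∂^{L^{−j}}_μB̃)(x)| ≦ O(1)p(Lʲε),
(2.98)  and it means that the regularity assumption is satisfied for the configurations B̃ and (2.93)."*  And (2.51) p. 569:
*"Ã^ε = (1 − θ₁)A₀ + Σ_{j=1}^{k−1}(1 − θ_{j+1})θ_jA^{(j),ε} + θ_kA^{(k),ε}"*; p. 567: θ_k *"is equal to 1 on B^{k−1}(Λ₂^{(k−1)}) and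
varies "smoothly" from 1 to 0 on a slice of thickness < M surrounding B^{k−1}(Λ₂^{(k−1)})"*.

THE ARGUMENT (the print's, made pointwise).  NESTING (r14's `Nested`: `θ_{m+1}θ_m = θ_{m+1}`, the regions shrink): at a point
of `Bʲ(Λ₂^{(j)})` one has `θ_{j+1} = 1`, hence `θ_m = 1` for all `m ≤ j + 1` and every coefficient `(1 − θ_{m+1})θ_m`, `m ≤ j`,
of (2.51) vanishes — (2.93) is (2.51) with the first `j` scales dropped, its last term `θ_kA^{(k)}` split by (2.88)/(2.89)
(`θ_{k+1}θ_k = θ_{k+1}`).  The *"remaining part"* `B̃` is again of the shape (2.51), one level up, with `B^{(k+1)}` in the last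
slot (`rem293_eq_aTilde251`), so the slice analysis is about (2.51): where every `θ_m` is `0` or `1` the nested coefficients
select exactly ONE scale `l` (`θ_l = 1`, `θ_{l+1} = 0`: `aTilde251_eq_single`) — the same one at both ends of a bond off the
slices, whence (2.95)'s first equality (`deriv_offSlice`); inside the slice around `Bˡ(Λ₂^{(l)})` only `θ_{l+1}` varies
(`θ_m = 1`, `m ≤ l`; `θ_m = 0`, `m ≥ l + 2`) and the field is `(1 − θ_{l+1})A^{(l)} + θ_{l+1}A^{(l+1)}` (`aTilde251_eq_two`), whose
lattice derivative obeys the exact product rule (2.96) (`eq296_exact`); (2.97)–(2.98) then combine Lemma 2.3 (2.59)/(2.60)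
(rescaled: `A^{(m)}(x) = A_m(y) + (L^{j−m})^{(d−2)/2}O(p(Lᵐε))`, `|∂A^{(m)}| ≤ O(1)p(Lʲε)`), the restriction
`|A_{l+1}(y′) − A_l(y)| ≤ (L^{j−l})^{(d−2)/2}O(p(Lˡε))` and `|∂θ_{l+1}| ≤ O(1)` by the triangle inequality, with
`(L^{j−l})^{(d−2)/2}p(Lˡε) ≤ p(Lʲε)` for `l ≥ j`, `d ≥ 2` (`scale297_le`: `L^{j−l} ≤ 1` and `p` antitone).

DICTIONARY.  `X` ↤ the points of `T_{L^{−j}}` (after the rescaling to the `L^{−j}`-lattice; the identities are pointwise and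
scale-free), `M` ↤ `ℝ^d` (values of the vector fields; any real vector space, normed for the bounds); `θ : ℕ → X → ℝ` ↤ the
cut-offs `θ_m`; `A₀`, `A : ℕ → X → M` ↤ `A₀`, `A^{(m),·}` of (2.51) (`A k` ↤ `A^{(k)}` of the translated field); `A'k`, `Bt`,
`Bn : X → M` ↤ `A′^{(k)}`, `B̃^{(k)}`, `B^{(k+1)}` of (2.89), entering through the pointwise hypothesis `h89` (= the seat's
`B2Eq289Decomposition.eq289`, not imported); a lattice derivative along a bond is the difference of the values at its two
ends `x`, `x⁺` (the factor `1/spacing` is a common positive constant and is omitted); `hx : θ (j+1) x = 1` ↤ `x ∈ Bʲ(Λ₂^{(j)})`.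

WHAT IS KERNEL-CHECKED (zero `sorry`, standard axioms; theorems only, NO definitions).
 §1 **(2.93)**: `Nested.eq_zero_of_ge` (zeros propagate upward), `aTilde251_tail` ((2.51) on `Bʲ(Λ₂^{(j)})`), **`eq293`**;
    `rem293_eq_aTilde251` (the remaining part `B̃` is (2.51) at level `k + 1` with `B^{(k+1)}` last);
 §2 **(2.95)**: `aTilde251_eq_A0`, `aTilde251_eq_single` (one scale survives where the θ's are 0/1), **`deriv_offSlice`**;
 §3 **(2.96)**: `aTilde251_eq_two` (two scales in a slice), **`eq296_exact`** (the product rule, exact), `eq296_bound`;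
 §4 **(2.97)–(2.98)**: `scale297_le`, **`ineq298`** (`‖∂B̃‖ ≤ (ϑ(2c₃ + c₄) + c₅)·p(Lʲε)` from the printed inputs).
HONEST SCOPE.  Lemma 2.3 (row B2.Lem2.3, proved on Bałaban's tori by p23) is NOT re-derived: its conclusions (2.59)/(2.60) in
the rescaled form of (2.95)/(2.97), the restriction on `A_{l+1}(y′) − A_l(y)` and `|∂θ| ≤ O(1)` enter `ineq298` as
hypotheses in printed form; (2.92) (the determinant representation) and (2.94) (the derivative clauses of (2.90)/(2.91)) are
not reproduced; the slice geometry (which θ's are constant near `x`) is the hypothesis of each pointwise statement.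
-/

namespace Literature.MathematicalPhysics.QuantumFieldTheory.Balaban1983to89.B2Eq293ExternalField

open Finset
open B2Sect2BDensities (aTilde251 aTilde245 Nested)

/-! ## §1 **(2.93)** p. 576 — (2.51) on `Bʲ(Λ₂^{(j)})` with the last term split by (2.88)/(2.89) -/

section Exact

variable {X M : Type*} [AddCommGroup M] [Module ℝ M]

omit [AddCommGroup M] [Module ℝ M] in
/-- Under nesting zeros propagate UPWARD: `θ_m(x) = 0 ⇒ θ_n(x) = 0` for `1 ≤ m ≤ n` (`θ_{n}θ_{n−1} = θ_n`). KERNEL.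
[cite: Balaban1982Higgs2, (2.51) p.569] -/
theorem Nested.eq_zero_of_ge {θ : ℕ → X → ℝ} (hθ : Nested θ) {m : ℕ} {x : X} (hm : 1 ≤ m) (h0 : θ m x = 0) :
    ∀ n, m ≤ n → θ n x = 0 := by
  intro n hmn
  induction n, hmn using Nat.le_induction with
  | base => exact h0
  | succ n hmn ih =>
    have h := hθ n x (le_trans hm hmn)
    rw [ih, mul_zero] at h
    exact h.symm

/-- **(2.51) on `Bʲ(Λ₂^{(j)})`**: where `θ_{j+1}(x) = 1` (so `θ_m(x) = 1` for all `m ≤ j + 1` by nesting) the first `j` scales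
drop out: `Ã^{(k)}(x) = Σ_{l=j+1}^{k−1}(1 − θ_{l+1})θ_lA^{(l)}(x) + θ_kA^{(k)}(x)` (`j + 1 ≤ k`). r14's `aTilde251_eq_aTilde245` is
the case `j = k − 2`. KERNEL. [cite: Balaban1982Higgs2, (2.93) p.576] -/
theorem aTilde251_tail {θ : ℕ → X → ℝ} (hθ : Nested θ) (A₀ : X → M) (A : ℕ → X → M) {j k : ℕ} (hjk : j + 1 ≤ k)
    {x : X} (hx : θ (j + 1) x = 1) :
    aTilde251 θ A₀ A k x = (∑ l ∈ Ico (j + 1) k, ((1 - θ (l + 1) x) * θ l x) • A l x) + θ k x • A k x := by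
  have hall : ∀ m, 1 ≤ m → m ≤ j + 1 → θ m x = 1 := hθ.eq_one_of_le hx
  have h1 : θ 1 x = 1 := hall 1 le_rfl (by omega)
  have hsplit : ∑ l ∈ Ico 1 k, ((1 - θ (l + 1) x) * θ l x) • A l x
      = ∑ l ∈ Ico 1 (j + 1), ((1 - θ (l + 1) x) * θ l x) • A l x
        + ∑ l ∈ Ico (j + 1) k, ((1 - θ (l + 1) x) * θ l x) • A l x :=
    (Finset.sum_Ico_consecutive _ (by omega) hjk).symm
  have hzero : ∑ l ∈ Ico 1 (j + 1), ((1 - θ (l + 1) x) * θ l x) • A l x = 0 := by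
    refine Finset.sum_eq_zero fun l hl => ?_
    rw [Finset.mem_Ico] at hl
    rw [hall (l + 1) (by omega) (by omega), sub_self, zero_mul, zero_smul]
  simp only [aTilde251, hsplit, hzero, h1, sub_self, zero_smul, zero_add]

/-- **(2.93)** p. 576, EXACT: at a point of `Bʲ(Λ₂^{(j)})` (`θ_{j+1} = 1`), for `j + 2 ≤ k`, under nesting and the pointwise
decomposition (2.89) `θ_{k+1}A^{(k)} = θ_{k+1}A′^{(k)} + B̃^{(k)} + θ_{k+1}B^{(k+1)}` (`h89`),
`Ã^{(k)} = (1 − θ_{j+2})θ_{j+1}A^{(j+1)} + Σ_{l=j+2}^{k−1}(1 − θ_{l+1})θ_lA^{(l)} + (1 − θ_{k+1})θ_kA^{(k)} + θ_{k+1}B^{(k+1)} +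
(θ_{k+1}A′^{(k)} + B̃^{(k)})`. [cite: Balaban1982Higgs2, (2.93) p.576] -/
theorem eq293 {θ : ℕ → X → ℝ} (hθ : Nested θ) (A₀ : X → M) (A : ℕ → X → M) (A'k Bt Bn : X → M) {j k : ℕ}
    (hjk : j + 2 ≤ k) {x : X} (hx : θ (j + 1) x = 1)
    (h89 : θ (k + 1) x • A k x = θ (k + 1) x • A'k x + Bt x + θ (k + 1) x • Bn x) :
    aTilde251 θ A₀ A k x
      = ((1 - θ (j + 2) x) * θ (j + 1) x) • A (j + 1) x
        + (∑ l ∈ Ico (j + 2) k, ((1 - θ (l + 1) x) * θ l x) • A l x)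
        + ((1 - θ (k + 1) x) * θ k x) • A k x + θ (k + 1) x • Bn x + (θ (k + 1) x • A'k x + Bt x) := by
  rw [aTilde251_tail hθ A₀ A (by omega) hx, Finset.sum_eq_sum_Ico_succ_bot (by omega)]
  have hnest : θ (k + 1) x * θ k x = θ (k + 1) x := hθ k x (by omega)
  have hsplit : θ k x • A k x = ((1 - θ (k + 1) x) * θ k x) • A k x + θ (k + 1) x • A k x := by
    rw [sub_mul, one_mul, hnest, sub_smul]
    abel
  rw [hsplit, h89]
  abel

/-- The *"remaining part"* `B̃` of (2.93) p. 576 — (2.93) minus the small field `θ_{k+1}A′^{(k)} + B̃^{(k)}`, i.e.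
`Σ_{l=j+1}^{k−1}(1 − θ_{l+1})θ_lA^{(l)} + (1 − θ_{k+1})θ_kA^{(k)} + θ_{k+1}B^{(k+1)}` — IS (2.51) one level up with `B^{(k+1)}` in the
last slot: for any sequence `A♯` agreeing with `A^{(l)}` for `l ≤ k` and with `A♯(k+1) = B^{(k+1)}`, at a point of `Bʲ(Λ₂^{(j)})`
it equals `Ã^{(k+1)}[A♯](x)` (`j + 1 ≤ k`). So the slice analysis (2.95)–(2.96) below is about (2.51). KERNEL.
[cite: Balaban1982Higgs2, (2.93) p.576] -/
theorem rem293_eq_aTilde251 {θ : ℕ → X → ℝ} (hθ : Nested θ) (A₀ : X → M) (A A' : ℕ → X → M) (Bn : X → M)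
    {j k : ℕ} (hjk : j + 1 ≤ k) {x : X} (hx : θ (j + 1) x = 1) (hA : ∀ l, l ≤ k → A' l x = A l x)
    (hB : A' (k + 1) x = Bn x) :
    (∑ l ∈ Ico (j + 1) k, ((1 - θ (l + 1) x) * θ l x) • A l x) + ((1 - θ (k + 1) x) * θ k x) • A k x
        + θ (k + 1) x • Bn x
      = aTilde251 θ A₀ A' (k + 1) x := by
  rw [aTilde251_tail hθ A₀ A' (by omega) hx, Finset.sum_Ico_succ_top hjk, hB, hA k le_rfl]
  congr 2
  exact Finset.sum_congr rfl fun l hl => by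
    rw [Finset.mem_Ico] at hl
    rw [hA l (by omega)]

/-! ## §2 **(2.95)** p. 576 — off the slices ONE scale survives -/

/-- Where `θ₁(x) = 0` (outside every region) all `θ_m(x) = 0` (`m ≥ 1`) and (2.51) is the original field:
`Ã(x) = A₀(x)` (`n ≥ 1`). KERNEL. [cite: Balaban1982Higgs2, (2.95) p.576] -/
theorem aTilde251_eq_A0 {θ : ℕ → X → ℝ} (hθ : Nested θ) (A₀ : X → M) (A : ℕ → X → M) {n : ℕ} (hn : 1 ≤ n) {x : X}
    (h0 : θ 1 x = 0) : aTilde251 θ A₀ A n x = A₀ x := by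
  have hz : ∀ m, 1 ≤ m → θ m x = 0 := fun m hm => Nested.eq_zero_of_ge hθ le_rfl h0 m hm
  have hsum : ∑ l ∈ Ico 1 n, ((1 - θ (l + 1) x) * θ l x) • A l x = 0 :=
    Finset.sum_eq_zero fun l hl => by
      rw [Finset.mem_Ico] at hl
      rw [hz l hl.1, mul_zero, zero_smul]
  simp [aTilde251, hsum, h0, hz n hn]

/-- **One scale survives** where the cut-offs are 0/1: if `θ_l(x) = 1` and `θ_{l+1}(x) = 0` (`1 ≤ l < n`) then, under nesting,
`θ_m(x) = 1` for `m ≤ l`, `θ_m(x) = 0` for `m > l`, and (2.51) at `x` is the single field `A^{(l)}(x)` — *"the derivative … is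
equal to one of the derivatives (∂A^{(l)})(x) … if the point x does not lie in a slice"*. KERNEL.
[cite: Balaban1982Higgs2, (2.95) p.576] -/
theorem aTilde251_eq_single {θ : ℕ → X → ℝ} (hθ : Nested θ) (A₀ : X → M) (A : ℕ → X → M) {l n : ℕ} (hl : 1 ≤ l)
    (hln : l < n) {x : X} (h1 : θ l x = 1) (h0 : θ (l + 1) x = 0) : aTilde251 θ A₀ A n x = A l x := by
  have hone : ∀ m, 1 ≤ m → m ≤ l → θ m x = 1 := hθ.eq_one_of_le h1
  have hzero : ∀ m, l + 1 ≤ m → θ m x = 0 := fun m hm => Nested.eq_zero_of_ge hθ (by omega) h0 m hm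
  have hθ1 : θ 1 x = 1 := hone 1 le_rfl hl
  have hsplit : ∑ m ∈ Ico 1 n, ((1 - θ (m + 1) x) * θ m x) • A m x
      = ∑ m ∈ Ico 1 l, ((1 - θ (m + 1) x) * θ m x) • A m x
        + ∑ m ∈ Ico l n, ((1 - θ (m + 1) x) * θ m x) • A m x :=
    (Finset.sum_Ico_consecutive _ hl hln.le).symm
  have hlow : ∑ m ∈ Ico 1 l, ((1 - θ (m + 1) x) * θ m x) • A m x = 0 :=
    Finset.sum_eq_zero fun m hm => by
      rw [Finset.mem_Ico] at hm
      rw [hone (m + 1) (by omega) (by omega), sub_self, zero_mul, zero_smul]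
  have hhigh : ∑ m ∈ Ico (l + 1) n, ((1 - θ (m + 1) x) * θ m x) • A m x = 0 :=
    Finset.sum_eq_zero fun m hm => by
      rw [Finset.mem_Ico] at hm
      rw [hzero m hm.1, mul_zero, zero_smul]
  rw [aTilde251, hsplit, hlow, Finset.sum_eq_sum_Ico_succ_bot hln, hhigh, hθ1, h1, h0, hzero n (by omega)]
  simp

/-- The top scale survives where `θ_n(x) = 1`: `Ã^{(n)}(x) = A^{(n)}(x)` (all lower coefficients vanish; `n ≥ 1`). KERNEL.
[cite: Balaban1982Higgs2, (2.95) p.576] -/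
theorem aTilde251_eq_top {θ : ℕ → X → ℝ} (hθ : Nested θ) (A₀ : X → M) (A : ℕ → X → M) {n : ℕ} (hn : 1 ≤ n) {x : X}
    (h1 : θ n x = 1) : aTilde251 θ A₀ A n x = A n x := by
  obtain ⟨m, rfl⟩ : ∃ m, n = m + 1 := ⟨n - 1, by omega⟩
  rw [aTilde251_tail hθ A₀ A le_rfl h1]
  simp [h1]

/-- **(2.95), first equality** p. 576: along a bond `(x, x⁺)` OFF the slices — the cut-offs take the same 0/1 pattern at both
ends, selecting the scale `l` (`θ_l = 1`, `θ_{l+1} = 0` at `x` and at `x⁺`) — the lattice derivative of the field (2.51) IS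
the derivative of the single field `A^{(l)}`: `Ã(x⁺) − Ã(x) = A^{(l)}(x⁺) − A^{(l)}(x)`. (The bound `≤ O(1)(L^{j−l})^{d/2}p(Lˡε)
≤ O(1)p(Lʲε)` is Lemma 2.3 (2.60), row B2.Lem2.3.) KERNEL. [cite: Balaban1982Higgs2, (2.95) p.576] -/
theorem deriv_offSlice {θ : ℕ → X → ℝ} (hθ : Nested θ) (A₀ : X → M) (A : ℕ → X → M) {l n : ℕ} (hl : 1 ≤ l)
    (hln : l < n) {x x' : X} (h1 : θ l x = 1) (h0 : θ (l + 1) x = 0) (h1' : θ l x' = 1) (h0' : θ (l + 1) x' = 0) :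
    aTilde251 θ A₀ A n x' - aTilde251 θ A₀ A n x = A l x' - A l x := by
  rw [aTilde251_eq_single hθ A₀ A hl hln h1 h0, aTilde251_eq_single hθ A₀ A hl hln h1' h0']

/-! ## §3 **(2.96)** p. 576 — in the slice around `Bˡ(Λ₂^{(l)})` two scales and the product rule -/

/-- **Two scales in a slice**: where `θ_l(x) = 1` and `θ_{l+2}(x) = 0` (the slice around `Bˡ(Λ₂^{(l)})`: only `θ_{l+1}`
varies; `1 ≤ l`, `l + 1 ≤ n`; for `l + 1 = n` the hypothesis on `θ_{l+2}` is not needed but harmless), (2.51) at `x` is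
`(1 − θ_{l+1}(x))A^{(l)}(x) + θ_{l+1}(x)A^{(l+1)}(x)`. KERNEL. [cite: Balaban1982Higgs2, (2.96) p.576] -/
theorem aTilde251_eq_two {θ : ℕ → X → ℝ} (hθ : Nested θ) (A₀ : X → M) (A : ℕ → X → M) {l n : ℕ} (hl : 1 ≤ l)
    (hln : l + 1 ≤ n) {x : X} (h1 : θ l x = 1) (h0 : θ (l + 2) x = 0) :
    aTilde251 θ A₀ A n x = (1 - θ (l + 1) x) • A l x + θ (l + 1) x • A (l + 1) x := by
  have hone : ∀ m, 1 ≤ m → m ≤ l → θ m x = 1 := hθ.eq_one_of_le h1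
  have hzero : ∀ m, l + 2 ≤ m → θ m x = 0 := fun m hm => Nested.eq_zero_of_ge hθ (by omega) h0 m hm
  -- (2.51) from scale l on (x lies in B^{l−1}(Λ₂^{(l−1)}): θ_l(x) = 1)
  obtain ⟨l', rfl⟩ : ∃ l', l = l' + 1 := ⟨l - 1, by omega⟩
  rw [aTilde251_tail hθ A₀ A (show l' + 1 ≤ n by omega) h1]
  rcases Nat.lt_or_ge (l' + 1 + 1) n with hlt | hge
  · -- l + 1 < n: the terms l, l+1 of the sum survive, the rest and the top vanish
    rw [Finset.sum_eq_sum_Ico_succ_bot (show l' + 1 < n by omega), Finset.sum_eq_sum_Ico_succ_bot hlt]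
    have hrest : ∑ m ∈ Ico (l' + 1 + 1 + 1) n, ((1 - θ (m + 1) x) * θ m x) • A m x = 0 :=
      Finset.sum_eq_zero fun m hm => by
        rw [Finset.mem_Ico] at hm
        rw [hzero m (by omega), mul_zero, zero_smul]
    rw [hrest, h1, hzero (l' + 1 + 1 + 1) (by omega), hzero n (by omega)]
    simp only [mul_one, sub_zero, one_mul, add_zero, zero_smul]
  · -- l + 1 = n: the sum has the single term l and the top term is θ_{l+1}A^{(l+1)}
    have hn : n = l' + 1 + 1 := by omega
    subst hn
    rw [Finset.sum_eq_sum_Ico_succ_bot (show l' + 1 < l' + 1 + 1 by omega), Finset.Ico_self, Finset.sum_empty, h1]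
    simp only [mul_one, add_zero]

/-- **(2.96)** p. 576, the product rule — EXACT: in the slice (two-scale form at both ends `x`, `x⁺` of a bond), with
`t = θ_{l+1}`, `Ã(x⁺) − Ã(x) = (t(x⁺) − t(x))·(A^{(l+1)}(x) − A^{(l)}(x)) + (1 − t(x⁺))·(A^{(l)}(x⁺) − A^{(l)}(x)) +
t(x⁺)·(A^{(l+1)}(x⁺) − A^{(l+1)}(x))` — the printed `(∂θ_{l+1})(x)(A^{(l+1)}(x) − A^{(l)}(x))` plus a convex combination of the
two one-scale derivatives (the printed `O(p(Lʲε))`, by (2.95)). KERNEL. [cite: Balaban1982Higgs2, (2.96) p.576] -/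
theorem eq296_exact {θ : ℕ → X → ℝ} (hθ : Nested θ) (A₀ : X → M) (A : ℕ → X → M) {l n : ℕ} (hl : 1 ≤ l)
    (hln : l + 1 ≤ n) {x x' : X} (h1 : θ l x = 1) (h0 : θ (l + 2) x = 0) (h1' : θ l x' = 1) (h0' : θ (l + 2) x' = 0) :
    aTilde251 θ A₀ A n x' - aTilde251 θ A₀ A n x
      = (θ (l + 1) x' - θ (l + 1) x) • (A (l + 1) x - A l x)
        + (1 - θ (l + 1) x') • (A l x' - A l x) + θ (l + 1) x' • (A (l + 1) x' - A (l + 1) x) := by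
  rw [aTilde251_eq_two hθ A₀ A hl hln h1 h0, aTilde251_eq_two hθ A₀ A hl hln h1' h0']
  simp only [smul_sub, sub_smul, one_smul]
  abel

end Exact

/-! ## §4 **(2.97)–(2.98)** p. 577 — the bound from Lemma 2.3's printed conclusions -/

section Bounds

variable {X M : Type*} [NormedAddCommGroup M] [NormedSpace ℝ M]

/-- **(2.96), bound**: in the slice, with `0 ≤ θ_{l+1}(x⁺) ≤ 1`,
`‖Ã(x⁺) − Ã(x)‖ ≤ |θ_{l+1}(x⁺) − θ_{l+1}(x)|·‖A^{(l+1)}(x) − A^{(l)}(x)‖ + max(‖A^{(l)}(x⁺) − A^{(l)}(x)‖, ‖A^{(l+1)}(x⁺) −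
A^{(l+1)}(x)‖)` (the convex combination is bounded by the larger one-scale derivative). [cite: Balaban1982Higgs2, (2.96) p.576] -/
theorem eq296_bound {θ : ℕ → X → ℝ} (hθ : Nested θ) (A₀ : X → M) (A : ℕ → X → M) {l n : ℕ} (hl : 1 ≤ l)
    (hln : l + 1 ≤ n) {x x' : X} (h1 : θ l x = 1) (h0 : θ (l + 2) x = 0) (h1' : θ l x' = 1) (h0' : θ (l + 2) x' = 0)
    (ht0 : 0 ≤ θ (l + 1) x') (ht1 : θ (l + 1) x' ≤ 1) :
    ‖aTilde251 θ A₀ A n x' - aTilde251 θ A₀ A n x‖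
      ≤ |θ (l + 1) x' - θ (l + 1) x| * ‖A (l + 1) x - A l x‖
        + max ‖A l x' - A l x‖ ‖A (l + 1) x' - A (l + 1) x‖ := by
  rw [eq296_exact hθ A₀ A hl hln h1 h0 h1' h0']
  set t := θ (l + 1) x' with ht
  set D₀ := A l x' - A l x
  set D₁ := A (l + 1) x' - A (l + 1) x
  have hconv : ‖(1 - t) • D₀ + t • D₁‖ ≤ max ‖D₀‖ ‖D₁‖ := by
    calc ‖(1 - t) • D₀ + t • D₁‖ ≤ ‖(1 - t) • D₀‖ + ‖t • D₁‖ := norm_add_le _ _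
      _ = (1 - t) * ‖D₀‖ + t * ‖D₁‖ := by
          rw [norm_smul, norm_smul, Real.norm_of_nonneg (by linarith), Real.norm_of_nonneg ht0]
      _ ≤ (1 - t) * max ‖D₀‖ ‖D₁‖ + t * max ‖D₀‖ ‖D₁‖ :=
          add_le_add (mul_le_mul_of_nonneg_left (le_max_left _ _) (by linarith))
            (mul_le_mul_of_nonneg_left (le_max_right _ _) ht0)
      _ = max ‖D₀‖ ‖D₁‖ := by ring
  have hfirst : ‖(t - θ (l + 1) x) • (A (l + 1) x - A l x)‖ = |t - θ (l + 1) x| * ‖A (l + 1) x - A l x‖ := by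
    rw [norm_smul, Real.norm_eq_abs]
  calc ‖(t - θ (l + 1) x) • (A (l + 1) x - A l x) + (1 - t) • D₀ + t • D₁‖
      ≤ ‖(t - θ (l + 1) x) • (A (l + 1) x - A l x)‖ + ‖(1 - t) • D₀ + t • D₁‖ := by
        rw [add_assoc]; exact norm_add_le _ _
    _ ≤ |t - θ (l + 1) x| * ‖A (l + 1) x - A l x‖ + max ‖D₀‖ ‖D₁‖ := by
        rw [hfirst]
        exact add_le_add le_rfl hconv

/-- **The scale factor of (2.95)/(2.97)**: for `l ≥ j`, `L ≥ 1`, `d ≥ 2` and `0 < Lʲε ≤ Lˡε ≤ 1`,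
`(L^{j−l})^{(d−2)/2}·p(Lˡε) ≤ p(Lʲε)` — `L^{j−l} ≤ 1` and `p` is antitone on `(0,1]` (`B1Ineq352Proof.pFn_anti`). With
`Lˡε = L^{l−j}·Lʲε` written as `s·ℓ`, `s ≥ 1`. [cite: Balaban1982Higgs2, (2.97) p.577] -/
theorem scale297_le {b₀ p s ℓ q : ℝ} (hb : 0 ≤ b₀) (hp : 0 ≤ p) (hℓ : 0 < ℓ) (hs : 1 ≤ s) (hsℓ : s * ℓ ≤ 1)
    (hq : 0 ≤ q) : (s⁻¹) ^ q * B2.pFn b₀ p (s * ℓ) ≤ B2.pFn b₀ p ℓ := by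
  have hs0 : 0 < s := lt_of_lt_of_le one_pos hs
  have hanti : B2.pFn b₀ p (s * ℓ) ≤ B2.pFn b₀ p ℓ :=
    B1Ineq352Proof.pFn_anti hb hp hℓ (le_mul_of_one_le_left hℓ.le hs) hsℓ
  have hpow : (s⁻¹) ^ q ≤ 1 := Real.rpow_le_one (inv_nonneg.2 hs0.le) (inv_le_one_of_one_le₀ hs) hq
  have hpos : 0 ≤ B2.pFn b₀ p (s * ℓ) := by
    unfold B2.pFn
    refine mul_nonneg hb (Real.rpow_nonneg ?_ _)
    have hlog : 0 ≤ Real.log (s * ℓ)⁻¹ := by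
      rw [Real.log_inv]
      have := Real.log_nonpos (mul_pos hs0 hℓ).le hsℓ
      linarith
    linarith
  calc (s⁻¹) ^ q * B2.pFn b₀ p (s * ℓ) ≤ 1 * B2.pFn b₀ p (s * ℓ) := mul_le_mul_of_nonneg_right hpow hpos
    _ = B2.pFn b₀ p (s * ℓ) := one_mul _
    _ ≤ B2.pFn b₀ p ℓ := hanti

/-- **(2.97)–(2.98)** p. 577: in the slice around `Bˡ(Λ₂^{(l)})`, from the PRINTED inputs — Lemma 2.3 (2.59) rescaled for the two
scales (`‖A^{(l)}(x) − A_l(y)‖`, `‖A^{(l+1)}(x) − A_{l+1}(y′)‖ ≤ c₃·σp_l` with `σp_l` ↤ `(L^{j−l})^{(d−2)/2}p(Lˡε)`), the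
restriction `‖A_{l+1}(y′) − A_l(y)‖ ≤ c₄·σp_l` (*"the restrictions on the fields A_l, A_{l+1} on the set Λ₀^{(l)}"*), Lemma 2.3
(2.60)/(2.95) for the one-scale derivatives (`≤ c₅·p(Lʲε)`), `|∂θ_{l+1}| ≤ ϑ` (the slice has thickness `< M`; `∂θ = O(1)`),
`σp_l ≤ p(Lʲε)` (`scale297_le`) — the derivative of the remaining field obeys `‖Ã(x⁺) − Ã(x)‖ ≤ (ϑ(2c₃ + c₄) + c₅)·p(Lʲε)`:
*"|(∂B̃)(x)| ≦ O(1)p(Lʲε) (2.98)"*. [cite: Balaban1982Higgs2, (2.98) p.577] -/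
theorem ineq298 {θ : ℕ → X → ℝ} (hθ : Nested θ) (A₀ : X → M) (A : ℕ → X → M) {l n : ℕ} (hl : 1 ≤ l)
    (hln : l + 1 ≤ n) {x x' : X} (h1 : θ l x = 1) (h0 : θ (l + 2) x = 0) (h1' : θ l x' = 1) (h0' : θ (l + 2) x' = 0)
    (ht0 : 0 ≤ θ (l + 1) x') (ht1 : θ (l + 1) x' ≤ 1) {al al1 : M} {c₃ c₄ c₅ ϑ σpl pj : ℝ}
    (hc₃ : 0 ≤ c₃) (hc₄ : 0 ≤ c₄) (hϑ : 0 ≤ ϑ)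
    (hdθ : |θ (l + 1) x' - θ (l + 1) x| ≤ ϑ)
    (h259l : ‖A l x - al‖ ≤ c₃ * σpl) (h259l1 : ‖A (l + 1) x - al1‖ ≤ c₃ * σpl) (hrestr : ‖al1 - al‖ ≤ c₄ * σpl)
    (h260l : ‖A l x' - A l x‖ ≤ c₅ * pj) (h260l1 : ‖A (l + 1) x' - A (l + 1) x‖ ≤ c₅ * pj) (hσ : σpl ≤ pj) :
    ‖aTilde251 θ A₀ A n x' - aTilde251 θ A₀ A n x‖ ≤ (ϑ * (2 * c₃ + c₄) + c₅) * pj := by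
  have hmain := eq296_bound hθ A₀ A hl hln h1 h0 h1' h0' ht0 ht1
  -- (2.97): A^{(l+1)}(x) − A^{(l)}(x) = [A^{(l+1)}(x) − A_{l+1}(y′)] + [A_{l+1}(y′) − A_l(y)] + [A_l(y) − A^{(l)}(x)]
  have h297 : ‖A (l + 1) x - A l x‖ ≤ (2 * c₃ + c₄) * σpl := by
    have hdec : A (l + 1) x - A l x = (A (l + 1) x - al1) + (al1 - al) + (al - A l x) := by abel
    rw [hdec]
    calc ‖A (l + 1) x - al1 + (al1 - al) + (al - A l x)‖
        ≤ ‖A (l + 1) x - al1‖ + ‖al1 - al‖ + ‖al - A l x‖ := norm_add₃_le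
      _ ≤ c₃ * σpl + c₄ * σpl + c₃ * σpl := by
          gcongr
          rwa [norm_sub_rev]
      _ = (2 * c₃ + c₄) * σpl := by ring
  have hA : |θ (l + 1) x' - θ (l + 1) x| * ‖A (l + 1) x - A l x‖ ≤ ϑ * ((2 * c₃ + c₄) * pj) := by
    refine mul_le_mul hdθ (h297.trans ?_) (norm_nonneg _) hϑ
    exact mul_le_mul_of_nonneg_left hσ (by positivity)
  have hmax : max ‖A l x' - A l x‖ ‖A (l + 1) x' - A (l + 1) x‖ ≤ c₅ * pj := max_le h260l h260l1
  calc ‖aTilde251 θ A₀ A n x' - aTilde251 θ A₀ A n x‖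
      ≤ |θ (l + 1) x' - θ (l + 1) x| * ‖A (l + 1) x - A l x‖
        + max ‖A l x' - A l x‖ ‖A (l + 1) x' - A (l + 1) x‖ := hmain
    _ ≤ ϑ * ((2 * c₃ + c₄) * pj) + c₅ * pj := add_le_add hA hmax
    _ = (ϑ * (2 * c₃ + c₄) + c₅) * pj := by ring

end Bounds

end Literature.MathematicalPhysics.QuantumFieldTheory.Balaban1983to89.B2Eq293ExternalField
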